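import Mathlib.Analysis.SpecialFunctions.Pow.Deriv
import Summits.QuantumFields.BalabanUV.Beta.EriceFlowEnclosureCesaroTwoThirdsLaw

/-!
# Beta / EriceFlowEnclosureCesaroTwoThirdsLawSharp — THE TWO-THIRDS LAW IS SHARP: the witness
#     **Φ(s) = s²·sin(s^{−1∕3})**,  φ = Φ′ = 2s·sin(s^{−1∕3}) − (1∕3)s^{2∕3}cos(s^{−1∕3}),  φ₁ = φ′
# meets EVERY hypothesis of P2 #56f `twoThirds_law` on ]0, 1[ with γ = 1 (Cesàro rate `|Φ s∕s| ≤ s`), window modulus constant L = 1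
# (`|φ₁′| ≤ 1∕s²`, so `|φ₁ u − φ₁ t| ≤ (u − t)∕t²`), and yet **`|φ(s_n)| = s_n^{2∕3}∕3`** at `s_n = (2πn)^{−3} → 0` — the exponent `2γ∕3 = 2∕3` of the
# two-thirds law is ATTAINED (and `twoThirds_law` itself gives `|φ| ≤ 7·s^{2∕3}` here).  So in row L120's class the loss per averaging is EXACTLY
# `γ ↦ 2γ∕3`, as the square root `γ ↦ γ∕2` is exactly the loss of the merely-bounded class (P2 #52a∕#52b, gen 39 rows L169–L171).  Everything is
# computed in the cube root `c = s^{1∕3}` (`Φ = c⁶ sin c⁻¹`, `d∕ds = (1∕(3c²))·d∕dc`).  Pure [folklore] calculus; no Erice sentence occurs.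
#   §1 the cube root: `cbrt_pos`, `cbrt_pow_three`, `cbrt_lt_one`, `hasDerivAt_cbrt`, `hasDerivAt_comp_cbrt`;
#   §2 the three identities in c: `hasDerivAt_G0`, `hasDerivAt_G1`, `hasDerivAt_G2` (`Gᵢ′ = 3c²·Gᵢ₊₁`), `G3_abs_le` (`|G₃ c| ≤ 1∕c⁶` for c ≤ 1);
#   §3 in s: `hasDerivAt_Phi`, `hasDerivAt_phi`, `hasDerivAt_phi1`, `phi1_windowModulus` (L = 1), `cesaro_rate` (`|Φ s∕s| ≤ s`), `phi_peak`
#      (`φ((2πn)^{−3}) = −(2πn)^{−2}∕3`);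
#   §4 END **`twoThirds_sharp`**.
# (β-flow team, prover 2 = lower ∕ positivity side, unit `b2b-balaban-beta-bflow-p2`, gen 39; module P2 #56g)

HONEST FRAMING (page 1 of everything the β sub-cell writes): discharging `BetaPertH` makes Bałaban's UV stability UNCONDITIONAL — a
real constructive-QFT result; it is NOT the continuum limit and NOT the Clay problem.  HONEST DEPENDENCY (cell reorg 2026-08-19,
verbatim): «continuum YM on T⁴ ⇐ BetaPertH ∧ nine spine estimates (0/9 proved); BetaPertH ⇐ (D1) ∧ (D4) ∧ CAP+tail; G-an2-4 gates
asym, D1 and NE2/3/4.»  THIS MODULE DISCHARGES NOTHING and quotes nothing: an explicit [toy] function and its first three derivatives.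

WHAT THIS FILE PROVES (0 sorry, 0 def): §1 `cbrt_pos`, `cbrt_pow_three`, `cbrt_lt_one`, `hasDerivAt_cbrt`, `hasDerivAt_comp_cbrt`; §2 `hasDerivAt_G0`,
`hasDerivAt_G1`, `hasDerivAt_G2`, `G3_abs_le`; §3 `hasDerivAt_Phi`, `hasDerivAt_phi`, `hasDerivAt_phi1`, `phi1_windowModulus`, `cesaro_rate`,
`phi_peak`; §4 END **`twoThirds_sharp`**.
NOT CLAIMED: that φ is itself the Cesàro mean of a bounded log-Lipschitz ψ (it is: ψ = (sφ)′ = 4s sin − (11∕9)s^{2∕3}cos − (1∕9)s^{1∕3}sin, |ψ′| ≲ 1∕s —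
not filed), i.e. sharpness stated at the level of P2 #56f `cesaro_twoThirds_of_cesaro2_power_rate`; the bare-side transfer; `BetaPertH`; continuum; Clay.
-/

namespace Summit.QuantumFields.BalabanUV.Beta.EriceFlowEnclosureCesaroTwoThirdsLawSharp

open Set Filter Topology MeasureTheory Asymptotics
open Summit.QuantumFields.BalabanUV.Beta.EriceFlowEnclosureCesaroTwoThirdsLaw (twoThirds_law)

noncomputable section

/-! ## §1 The cube root `c = s^{1∕3}` -/

/-- `s^{1∕3} > 0` for s > 0. [folklore] -/
theorem cbrt_pos {s : ℝ} (hs : 0 < s) : 0 < s ^ (3:ℝ)⁻¹ := Real.rpow_pos_of_pos hs _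

/-- `(s^{1∕3})³ = s` for s ≥ 0. [folklore] -/
theorem cbrt_pow_three {s : ℝ} (hs : 0 ≤ s) : (s ^ (3:ℝ)⁻¹) ^ 3 = s := by
  have h := Real.rpow_inv_natCast_pow (n := 3) hs (by norm_num)
  exact_mod_cast h

/-- `s^{1∕3} < 1` for `0 ≤ s < 1`. [folklore] -/
theorem cbrt_lt_one {s : ℝ} (hs : 0 ≤ s) (hs1 : s < 1) : s ^ (3:ℝ)⁻¹ < 1 := Real.rpow_lt_one hs hs1 (by norm_num)

/-- `(s^{1∕3})′ = 1∕(3·(s^{1∕3})²)` for s > 0. [folklore] -/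
theorem hasDerivAt_cbrt {s : ℝ} (hs : 0 < s) : HasDerivAt (fun x : ℝ => x ^ (3:ℝ)⁻¹) (1 / (3 * (s ^ (3:ℝ)⁻¹) ^ 2)) s := by
  have h := Real.hasDerivAt_rpow_const (p := (3:ℝ)⁻¹) (Or.inl hs.ne')
  refine h.congr_deriv ?_
  have hc := cbrt_pos hs
  have hc3 := cbrt_pow_three hs.le
  rw [Real.rpow_sub_one hs.ne']
  set c := s ^ (3:ℝ)⁻¹ with hcdef
  rw [← hc3]
  field_simp

/-- CHAIN RULE THROUGH THE CUBE ROOT: `HasDerivAt G g′ (s^{1∕3}) ⟹ HasDerivAt (G ∘ cbrt) (g′∕(3(s^{1∕3})²)) s`. [folklore] -/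
theorem hasDerivAt_comp_cbrt {G : ℝ → ℝ} {g' s : ℝ} (hs : 0 < s) (hG : HasDerivAt G g' (s ^ (3:ℝ)⁻¹)) :
    HasDerivAt (fun x : ℝ => G (x ^ (3:ℝ)⁻¹)) (g' / (3 * (s ^ (3:ℝ)⁻¹) ^ 2)) s := by
  have h := hG.comp s (hasDerivAt_cbrt hs)
  refine h.congr_deriv ?_
  field_simp

/-! ## §2 The three identities in the cube root -/

/-- `G₀(c) = c⁶ sin c⁻¹` has `G₀′(c) = 3c²·G₁(c)`, `G₁(c) = 2c³ sin c⁻¹ − (1∕3)c² cos c⁻¹` (c ≠ 0). [folklore calculus] -/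
theorem hasDerivAt_G0 {c : ℝ} (hc : c ≠ 0) :
    HasDerivAt (fun y : ℝ => y ^ 6 * Real.sin y⁻¹)
      (3 * c ^ 2 * (2 * c ^ 3 * Real.sin c⁻¹ - 1 / 3 * c ^ 2 * Real.cos c⁻¹)) c := by
  have hinv := hasDerivAt_inv hc
  have h := (hasDerivAt_pow 6 c).mul hinv.sin
  refine h.congr_deriv ?_
  field_simp
  ring

/-- `G₁′(c) = 3c²·G₂(c)`, `G₂(c) = 2 sin c⁻¹ − (8∕9)cos c⁻¹∕c − (1∕9) sin c⁻¹∕c²` (c ≠ 0). [folklore calculus] -/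
theorem hasDerivAt_G1 {c : ℝ} (hc : c ≠ 0) :
    HasDerivAt (fun y : ℝ => 2 * y ^ 3 * Real.sin y⁻¹ - 1 / 3 * y ^ 2 * Real.cos y⁻¹)
      (3 * c ^ 2 * (2 * Real.sin c⁻¹ - 8 / 9 * (Real.cos c⁻¹ / c) - 1 / 9 * (Real.sin c⁻¹ / c ^ 2))) c := by
  have hinv := hasDerivAt_inv hc
  have h1 := ((hasDerivAt_pow 3 c).const_mul 2).mul hinv.sin
  have h2 := ((hasDerivAt_pow 2 c).const_mul (1 / 3)).mul hinv.cos
  have h := h1.sub h2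
  refine h.congr_deriv ?_
  field_simp
  ring

/-- `G₂′(c) = 3c²·G₃(c)`, `G₃(c) = −(10∕27)cos c⁻¹∕c⁴ − (2∕9) sin c⁻¹∕c⁵ + (1∕27)cos c⁻¹∕c⁶` (c ≠ 0). [folklore calculus] -/
theorem hasDerivAt_G2 {c : ℝ} (hc : c ≠ 0) :
    HasDerivAt (fun y : ℝ => 2 * Real.sin y⁻¹ - 8 / 9 * (Real.cos y⁻¹ / y) - 1 / 9 * (Real.sin y⁻¹ / y ^ 2))
      (3 * c ^ 2 * (-(10 / 27) * (Real.cos c⁻¹ / c ^ 4) - 2 / 9 * (Real.sin c⁻¹ / c ^ 5) + 1 / 27 * (Real.cos c⁻¹ / c ^ 6))) c := by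
  have hinv := hasDerivAt_inv hc
  have h1 := hinv.sin.const_mul 2
  have h2 := (hinv.cos.div (hasDerivAt_id c) hc).const_mul (8 / 9)
  have h3 := (hinv.sin.div (hasDerivAt_pow 2 c) (pow_ne_zero 2 hc)).const_mul (1 / 9)
  have h := (h1.sub h2).sub h3
  refine h.congr_deriv ?_
  simp only [id]
  field_simp
  ring

/-- `|G₃ c| ≤ 1∕c⁶` for `0 < c ≤ 1` (`10∕27 + 6∕27 + 1∕27 = 17∕27 ≤ 1`, `1∕c⁴, 1∕c⁵ ≤ 1∕c⁶`). [folklore] -/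
theorem G3_abs_le {c : ℝ} (hc : 0 < c) (hc1 : c ≤ 1) :
    |-(10 / 27) * (Real.cos c⁻¹ / c ^ 4) - 2 / 9 * (Real.sin c⁻¹ / c ^ 5) + 1 / 27 * (Real.cos c⁻¹ / c ^ 6)| ≤ 1 / c ^ 6 := by
  have h4 : 1 / c ^ 4 ≤ 1 / c ^ 6 := one_div_le_one_div_of_le (pow_pos hc 6) (pow_le_pow_of_le_one hc.le hc1 (by norm_num))
  have h5 : 1 / c ^ 5 ≤ 1 / c ^ 6 := one_div_le_one_div_of_le (pow_pos hc 6) (pow_le_pow_of_le_one hc.le hc1 (by norm_num))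
  have hb : ∀ (f : ℝ) (k : ℕ), |f| ≤ 1 → |f / c ^ k| ≤ 1 / c ^ k := fun f k hf => by
    rw [abs_div, abs_of_pos (pow_pos hc k)]; exact div_le_div_of_nonneg_right hf (pow_pos hc k).le
  have a1 := (hb (Real.cos c⁻¹) 4 (Real.abs_cos_le_one _)).trans h4
  have a2 := (hb (Real.sin c⁻¹) 5 (Real.abs_sin_le_one _)).trans h5
  have a3 := hb (Real.cos c⁻¹) 6 (Real.abs_cos_le_one _)
  have e1 : |-(10 / 27) * (Real.cos c⁻¹ / c ^ 4)| = 10 / 27 * |Real.cos c⁻¹ / c ^ 4| := by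
    rw [abs_mul, abs_neg, abs_of_pos (by norm_num : (0:ℝ) < 10 / 27)]
  have e2 : |2 / 9 * (Real.sin c⁻¹ / c ^ 5)| = 2 / 9 * |Real.sin c⁻¹ / c ^ 5| := by
    rw [abs_mul, abs_of_pos (by norm_num : (0:ℝ) < 2 / 9)]
  have e3 : |1 / 27 * (Real.cos c⁻¹ / c ^ 6)| = 1 / 27 * |Real.cos c⁻¹ / c ^ 6| := by
    rw [abs_mul, abs_of_pos (by norm_num : (0:ℝ) < 1 / 27)]
  calc _ ≤ |-(10 / 27) * (Real.cos c⁻¹ / c ^ 4) - 2 / 9 * (Real.sin c⁻¹ / c ^ 5)| + |1 / 27 * (Real.cos c⁻¹ / c ^ 6)| := abs_add_le _ _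
    _ ≤ |-(10 / 27) * (Real.cos c⁻¹ / c ^ 4)| + |2 / 9 * (Real.sin c⁻¹ / c ^ 5)| + |1 / 27 * (Real.cos c⁻¹ / c ^ 6)| := by
        linarith [abs_sub (-(10 / 27) * (Real.cos c⁻¹ / c ^ 4)) (2 / 9 * (Real.sin c⁻¹ / c ^ 5))]
    _ = 10 / 27 * |Real.cos c⁻¹ / c ^ 4| + 2 / 9 * |Real.sin c⁻¹ / c ^ 5| + 1 / 27 * |Real.cos c⁻¹ / c ^ 6| := by rw [e1, e2, e3]
    _ ≤ 10 / 27 * (1 / c ^ 6) + 2 / 9 * (1 / c ^ 6) + 1 / 27 * (1 / c ^ 6) := by gcongr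
    _ = (17 / 27) / c ^ 6 := by ring
    _ ≤ 1 / c ^ 6 := div_le_div_of_nonneg_right (by norm_num) (pow_pos hc 6).le

/-! ## §3 In the variable s: three derivatives, the window modulus, the Cesàro rate, the peaks -/

/-- **`Φ′ = φ`** on s > 0: `Φ(s) = (s^{1∕3})⁶ sin((s^{1∕3})⁻¹)` (= `s² sin s^{−1∕3}`), `φ(s) = 2c³ sin c⁻¹ − (1∕3)c² cos c⁻¹`, `c = s^{1∕3}`. [folklore] -/
theorem hasDerivAt_Phi {s : ℝ} (hs : 0 < s) :
    HasDerivAt (fun x : ℝ => (x ^ (3:ℝ)⁻¹) ^ 6 * Real.sin (x ^ (3:ℝ)⁻¹)⁻¹)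
      (2 * (s ^ (3:ℝ)⁻¹) ^ 3 * Real.sin (s ^ (3:ℝ)⁻¹)⁻¹ - 1 / 3 * (s ^ (3:ℝ)⁻¹) ^ 2 * Real.cos (s ^ (3:ℝ)⁻¹)⁻¹) s := by
  have hc := cbrt_pos hs
  have h := hasDerivAt_comp_cbrt hs (hasDerivAt_G0 hc.ne')
  refine h.congr_deriv ?_
  field_simp

/-- **`φ′ = φ₁`** on s > 0: `φ₁(s) = 2 sin c⁻¹ − (8∕9)cos c⁻¹∕c − (1∕9) sin c⁻¹∕c²`, `c = s^{1∕3}`. [folklore] -/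
theorem hasDerivAt_phi {s : ℝ} (hs : 0 < s) :
    HasDerivAt (fun x : ℝ => 2 * (x ^ (3:ℝ)⁻¹) ^ 3 * Real.sin (x ^ (3:ℝ)⁻¹)⁻¹ - 1 / 3 * (x ^ (3:ℝ)⁻¹) ^ 2 * Real.cos (x ^ (3:ℝ)⁻¹)⁻¹)
      (2 * Real.sin (s ^ (3:ℝ)⁻¹)⁻¹ - 8 / 9 * (Real.cos (s ^ (3:ℝ)⁻¹)⁻¹ / s ^ (3:ℝ)⁻¹)
        - 1 / 9 * (Real.sin (s ^ (3:ℝ)⁻¹)⁻¹ / (s ^ (3:ℝ)⁻¹) ^ 2)) s := by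
  have hc := cbrt_pos hs
  have h := hasDerivAt_comp_cbrt hs (hasDerivAt_G1 hc.ne')
  refine h.congr_deriv ?_
  field_simp

/-- **`φ₁′ = G₃ ∘ cbrt`** on s > 0. [folklore] -/
theorem hasDerivAt_phi1 {s : ℝ} (hs : 0 < s) :
    HasDerivAt (fun x : ℝ => 2 * Real.sin (x ^ (3:ℝ)⁻¹)⁻¹ - 8 / 9 * (Real.cos (x ^ (3:ℝ)⁻¹)⁻¹ / x ^ (3:ℝ)⁻¹)
        - 1 / 9 * (Real.sin (x ^ (3:ℝ)⁻¹)⁻¹ / (x ^ (3:ℝ)⁻¹) ^ 2))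
      (-(10 / 27) * (Real.cos (s ^ (3:ℝ)⁻¹)⁻¹ / (s ^ (3:ℝ)⁻¹) ^ 4) - 2 / 9 * (Real.sin (s ^ (3:ℝ)⁻¹)⁻¹ / (s ^ (3:ℝ)⁻¹) ^ 5)
        + 1 / 27 * (Real.cos (s ^ (3:ℝ)⁻¹)⁻¹ / (s ^ (3:ℝ)⁻¹) ^ 6)) s := by
  have hc := cbrt_pos hs
  have h := hasDerivAt_comp_cbrt hs (hasDerivAt_G2 hc.ne')
  refine h.congr_deriv ?_
  field_simp

/-- **THE WINDOW MODULUS WITH L = 1**: for `0 < t ≤ u < 1`, `|φ₁ u − φ₁ t| ≤ 1·(u − t)∕t²` (`|φ₁′(x)| = |G₃(x^{1∕3})| ≤ 1∕x² ≤ 1∕t²` on [t, u]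
by §2 with `(x^{1∕3})⁶ = x²`, and the mean value inequality). [folklore] -/
theorem phi1_windowModulus : ∀ t u : ℝ, 0 < t → t ≤ u → u < 1 →
    |(2 * Real.sin (u ^ (3:ℝ)⁻¹)⁻¹ - 8 / 9 * (Real.cos (u ^ (3:ℝ)⁻¹)⁻¹ / u ^ (3:ℝ)⁻¹)
        - 1 / 9 * (Real.sin (u ^ (3:ℝ)⁻¹)⁻¹ / (u ^ (3:ℝ)⁻¹) ^ 2))
      - (2 * Real.sin (t ^ (3:ℝ)⁻¹)⁻¹ - 8 / 9 * (Real.cos (t ^ (3:ℝ)⁻¹)⁻¹ / t ^ (3:ℝ)⁻¹)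
        - 1 / 9 * (Real.sin (t ^ (3:ℝ)⁻¹)⁻¹ / (t ^ (3:ℝ)⁻¹) ^ 2))| ≤ 1 * (u - t) / t ^ 2 := by
  intro t u ht htu hu1
  have hder : ∀ x ∈ Icc t u, HasDerivWithinAt
      (fun x : ℝ => 2 * Real.sin (x ^ (3:ℝ)⁻¹)⁻¹ - 8 / 9 * (Real.cos (x ^ (3:ℝ)⁻¹)⁻¹ / x ^ (3:ℝ)⁻¹)
        - 1 / 9 * (Real.sin (x ^ (3:ℝ)⁻¹)⁻¹ / (x ^ (3:ℝ)⁻¹) ^ 2))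
      (-(10 / 27) * (Real.cos (x ^ (3:ℝ)⁻¹)⁻¹ / (x ^ (3:ℝ)⁻¹) ^ 4) - 2 / 9 * (Real.sin (x ^ (3:ℝ)⁻¹)⁻¹ / (x ^ (3:ℝ)⁻¹) ^ 5)
        + 1 / 27 * (Real.cos (x ^ (3:ℝ)⁻¹)⁻¹ / (x ^ (3:ℝ)⁻¹) ^ 6)) (Icc t u) x :=
    fun x hx => (hasDerivAt_phi1 (ht.trans_le hx.1)).hasDerivWithinAt
  have hbound : ∀ x ∈ Icc t u, ‖-(10 / 27) * (Real.cos (x ^ (3:ℝ)⁻¹)⁻¹ / (x ^ (3:ℝ)⁻¹) ^ 4)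
      - 2 / 9 * (Real.sin (x ^ (3:ℝ)⁻¹)⁻¹ / (x ^ (3:ℝ)⁻¹) ^ 5) + 1 / 27 * (Real.cos (x ^ (3:ℝ)⁻¹)⁻¹ / (x ^ (3:ℝ)⁻¹) ^ 6)‖ ≤ 1 / t ^ 2 := by
    intro x hx
    have hx0 : 0 < x := ht.trans_le hx.1
    have hx1 : x < 1 := lt_of_le_of_lt hx.2 hu1
    have hc := cbrt_pos hx0
    have hc1 := (cbrt_lt_one hx0.le hx1).le
    have hc6 : (x ^ (3:ℝ)⁻¹) ^ 6 = x ^ 2 := by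
      rw [show (6:ℕ) = 3 * 2 by norm_num, pow_mul, cbrt_pow_three hx0.le]
    rw [Real.norm_eq_abs]
    refine (G3_abs_le hc hc1).trans ?_
    rw [hc6]
    exact one_div_le_one_div_of_le (pow_pos ht 2) (pow_le_pow_left₀ ht.le hx.1 2)
  have h := Convex.norm_image_sub_le_of_norm_hasDerivWithin_le hder hbound (convex_Icc t u) (left_mem_Icc.mpr htu)
    (right_mem_Icc.mpr htu)
  rw [Real.norm_eq_abs, Real.norm_eq_abs, abs_of_nonneg (sub_nonneg.mpr htu)] at h
  calc _ ≤ 1 / t ^ 2 * (u - t) := h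
    _ = 1 * (u - t) / t ^ 2 := by ring

/-- **THE CESÀRO RATE WITH A = 1, γ = 1**: `|Φ s∕s − 0| ≤ 1·s^1` on s > 0 (`Φ s∕s = s·sin s^{−1∕3}`). [folklore] -/
theorem cesaro_rate : ∀ s ∈ Ioc (0:ℝ) 1,
    |(s ^ (3:ℝ)⁻¹) ^ 6 * Real.sin (s ^ (3:ℝ)⁻¹)⁻¹ / s - 0| ≤ 1 * s ^ (1:ℝ) := by
  intro s hs
  have hc6 : (s ^ (3:ℝ)⁻¹) ^ 6 = s ^ 2 := by
    rw [show (6:ℕ) = 3 * 2 by norm_num, pow_mul, cbrt_pow_three hs.1.le]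
  rw [sub_zero, Real.rpow_one, one_mul, hc6, pow_two, mul_assoc, mul_div_assoc, mul_div_cancel_left₀ _ hs.1.ne', abs_mul,
    abs_of_pos hs.1]
  calc s * |Real.sin (s ^ (3:ℝ)⁻¹)⁻¹| ≤ s * 1 := mul_le_mul_of_nonneg_left (Real.abs_sin_le_one _) hs.1.le
    _ = s := mul_one s

/-- **THE PEAKS**: at `s_n = ((2πn)⁻¹)³` (n ≥ 1) the cube root is `(2πn)⁻¹`, `sin(2πn) = 0`, `cos(2πn) = 1`, so
**`φ(s_n) = −(1∕3)·((2πn)⁻¹)²`** — of size exactly `s_n^{2∕3}∕3`. [folklore] -/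
theorem phi_peak (n : ℕ) (hn : 1 ≤ n) :
    2 * ((((2 * Real.pi * n)⁻¹) ^ 3) ^ (3:ℝ)⁻¹) ^ 3 * Real.sin ((((2 * Real.pi * n)⁻¹) ^ 3) ^ (3:ℝ)⁻¹)⁻¹
      - 1 / 3 * ((((2 * Real.pi * n)⁻¹) ^ 3) ^ (3:ℝ)⁻¹) ^ 2 * Real.cos ((((2 * Real.pi * n)⁻¹) ^ 3) ^ (3:ℝ)⁻¹)⁻¹
      = -(1 / 3) * ((2 * Real.pi * n)⁻¹) ^ 2 := by
  have hπn : 0 < 2 * Real.pi * n := by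
    have : (1:ℝ) ≤ n := by exact_mod_cast hn
    have := Real.pi_pos
    positivity
  have hcb : (((2 * Real.pi * n)⁻¹) ^ 3) ^ (3:ℝ)⁻¹ = (2 * Real.pi * n)⁻¹ := by
    have h := Real.pow_rpow_inv_natCast (n := 3) (inv_nonneg.mpr hπn.le) (by norm_num)
    exact_mod_cast h
  rw [hcb, inv_inv]
  have hsin : Real.sin (2 * Real.pi * n) = 0 := by
    rw [show 2 * Real.pi * n = ((2 * n : ℕ) : ℝ) * Real.pi by push_cast; ring]; exact Real.sin_nat_mul_pi (2 * n)
  have hcos : Real.cos (2 * Real.pi * n) = 1 := by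
    rw [show 2 * Real.pi * n = (n : ℝ) * (2 * Real.pi) by ring]; exact Real.cos_nat_mul_two_pi n
  rw [hsin, hcos]
  ring

/-! ## §4 END — the two-thirds law is sharp -/

/-- **END — THE TWO-THIRDS LAW IS SHARP.**  There are Φ, φ, φ₁ on ]0, 1[ (Φ = s² sin s^{−1∕3} and its first two derivatives) with `Φ′ = φ`,
`φ′ = φ₁`, the window modulus `|φ₁ u − φ₁ t| ≤ 1·(u − t)∕t²` (0 < t ≤ u < 1), the Cesàro rate `|Φ s∕s − 0| ≤ 1·s^1` on ]0, 1] — so P2 #56f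
`twoThirds_law` applies with (L, A, γ, m) = (1, 1, 1, 0) and gives `|φ t| ≤ 7·t^{2∕3}` near 0⁺ — AND a sequence `s_n → 0⁺` with
**`|φ(s_n)| = s_n^{2∕3}∕3`**: the exponent 2∕3 cannot be improved.  [toy; folklore] -/
theorem twoThirds_sharp :
    ∃ Φ φ φ₁ : ℝ → ℝ,
      (∀ t ∈ Ioo (0:ℝ) 1, HasDerivAt Φ (φ t) t) ∧ (∀ t ∈ Ioo (0:ℝ) 1, HasDerivAt φ (φ₁ t) t) ∧
      (∀ t u : ℝ, 0 < t → t ≤ u → u < 1 → |φ₁ u - φ₁ t| ≤ 1 * (u - t) / t ^ 2) ∧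
      (∀ s ∈ Ioc (0:ℝ) 1, |Φ s / s - 0| ≤ 1 * s ^ (1:ℝ)) ∧
      (∀ t ∈ Ioc 0 (min ((1 / 2 : ℝ) ^ (3 / (1:ℝ))) (min ((1:ℝ) / 2) ((1:ℝ) / 2))), |φ t - 0| ≤ (3 * 1 + 4 * 1) * t ^ (2 * (1:ℝ) / 3)) ∧
      ∃ sq : ℕ → ℝ, (∀ n, 1 ≤ n → sq n ∈ Ioo (0:ℝ) 1) ∧ Tendsto sq atTop (𝓝 0) ∧
        ∀ n, 1 ≤ n → |φ (sq n)| = 1 / 3 * (sq n) ^ (2 * (1:ℝ) / 3) := by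
  refine ⟨fun x => (x ^ (3:ℝ)⁻¹) ^ 6 * Real.sin (x ^ (3:ℝ)⁻¹)⁻¹,
    fun x => 2 * (x ^ (3:ℝ)⁻¹) ^ 3 * Real.sin (x ^ (3:ℝ)⁻¹)⁻¹ - 1 / 3 * (x ^ (3:ℝ)⁻¹) ^ 2 * Real.cos (x ^ (3:ℝ)⁻¹)⁻¹,
    fun x => 2 * Real.sin (x ^ (3:ℝ)⁻¹)⁻¹ - 8 / 9 * (Real.cos (x ^ (3:ℝ)⁻¹)⁻¹ / x ^ (3:ℝ)⁻¹)
        - 1 / 9 * (Real.sin (x ^ (3:ℝ)⁻¹)⁻¹ / (x ^ (3:ℝ)⁻¹) ^ 2),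
    fun t ht => hasDerivAt_Phi ht.1, fun t ht => hasDerivAt_phi ht.1, phi1_windowModulus, cesaro_rate, ?_, ?_⟩
  · exact twoThirds_law (δ := 1) (τ := 1) (fun t ht => hasDerivAt_Phi ht.1) (fun t ht => hasDerivAt_phi ht.1) zero_le_one
      phi1_windowModulus zero_le_one one_pos le_rfl cesaro_rate
  · refine ⟨fun n => ((2 * Real.pi * n)⁻¹) ^ 3, fun n hn => ?_, ?_, fun n hn => ?_⟩
    · have h1 : (1:ℝ) ≤ n := by exact_mod_cast hn
      have hπ := Real.two_le_pi
      have hbig : 1 < 2 * Real.pi * n := by nlinarith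
      have hinv : 0 < (2 * Real.pi * n)⁻¹ := inv_pos.mpr (by linarith)
      have hinv1 : (2 * Real.pi * n)⁻¹ < 1 := inv_lt_one_of_one_lt₀ hbig
      exact ⟨pow_pos hinv 3, pow_lt_one₀ hinv.le hinv1 (by norm_num)⟩
    · have h1 : Tendsto (fun n : ℕ => 2 * Real.pi * (n : ℝ)) atTop atTop :=
        tendsto_natCast_atTop_atTop.const_mul_atTop (by positivity)
      have h2 := tendsto_inv_atTop_zero.comp h1
      have h3 := h2.pow 3
      rw [zero_pow (by norm_num)] at h3
      exact h3
    · beta_reduce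
      rw [phi_peak n hn]
      have hπn : 0 < 2 * Real.pi * n := by
        have : (1:ℝ) ≤ n := by exact_mod_cast hn
        have := Real.pi_pos
        positivity
      have hq : 0 ≤ (2 * Real.pi * n)⁻¹ := inv_nonneg.mpr hπn.le
      have h23 : (((2 * Real.pi * n)⁻¹) ^ 3) ^ (2 * (1:ℝ) / 3) = ((2 * Real.pi * n)⁻¹) ^ 2 := by
        rw [← Real.rpow_natCast _ 3, ← Real.rpow_mul hq, ← Real.rpow_natCast _ 2]
        norm_num
      rw [h23, abs_mul, abs_neg, abs_of_pos (by norm_num : (0:ℝ) < 1 / 3), abs_of_nonneg (pow_nonneg hq 2)]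

end

end Summit.QuantumFields.BalabanUV.Beta.EriceFlowEnclosureCesaroTwoThirdsLawSharp
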